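import Summits.FinalStateConjecture.FinalStateConjecture.Theorems.PhotonSphereChannelsChannelsResolveTameDevelopmentsRMinkowskiMaximal
import Summits.FinalStateConjecture.FinalStateConjecture.Theorems.ZeroEnergyKerrOrBombStationaryLimitReductionOneDevelopment
import Summits.FinalStateConjecture.FinalStateConjecture.Theorems.PhaseMixingCaptureWeakCosmicCensorshipMGHDCompleteNullInfinityInvariant
import Summits.FinalStateConjecture.FinalStateConjecture.Theorems.EIHFluxBalanceModulatedKerrHandoffStubRaysStayInClosureTransport
import Summits.FinalStateConjecture.FinalStateConjecture.Theorems.EIHFluxBalanceModulatedKerrHandoffStubRayTransport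
import Summits.FinalStateConjecture.FinalStateConjecture.Theorems.RenormalisedDriftDriftCaptureStubFlatLateChartOfTracking
import HarnessLib

/-!
# DriftCapture holds, non-vacuously for `N = 0`, on the whole fibre over the trivial datum

Crux `DriftCapture` (item `stmt-FinalStateConjecture-17391`, route RenormalisedDrift, skeleton
`Cruxes/DriftCapture/Lines/birth.lean`, stub `stub_flatChartOfTrackingUnoriented`, FLAT case `N = 0`):
the MODEL CERTIFICATE at the trivial datum `(ℝ³, δ, 0)` — two registered sub-goals and a bundle.

* (A) `driftCapture_trivialData` — the BODY of the crux at `X = Minkowski.slice`, `D = trivialData`, for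
  EVERY maximal vacuum Cauchy development `𝒟` and every `(N, m₀, χ)`, UNCONDITIONALLY: the five-clause
  T2 conclusion is the second component of `SettlesT2 𝒟`, which holds on the whole fibre — `𝒟` is
  isometric, as a development, to Minkowski space (`Minkowski.isIsometricTo_vacuumCauchyDevelopment_of_isMaximal`:
  Minkowski space is geodesically complete, O'Neill 1983, Cor. 7.29, so it embeds ONTO `𝒟`,
  Choquet-Bruhat–Geroch 1969, Thm. 3), Minkowski space settles (T2) (`TrivialDatum.settlesT2_minkowski`,
  Christodoulou–Klainerman 1993, Thm. 1.0.2), and the clause rides along the isometry. That transport is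
  the sister crux's `ChannelsResolveTameDevelopmentsR.TrivialDatum.settlesT2_of_isMaximal`
  (`…RTrivialDatumMGHD.lean`), a landed module WITHOUT olean on the Lean farm (2026-08-17); its 30-line
  proof is re-assembled here, privately and verbatim, from its BUILT constituents.
* (B) `isAdiabaticallyTracked_zero_minkowski` — the crux's HYPOTHESIS at `N = 0` is REALISED in
  `Minkowski.vacuumCauchyDevelopment`: for every `L > 0` and EVERY accuracy `ε`, `m₀`, `χ`, `R₀`, it is
  adiabatically tracked with no hole by identity flat windows marching to the future — `O = {x⁰ ≥ 0}`,
  `Uₙ = E4`, `φₙ(y) = y + (nL/2) ∂₀` (an exact isometry of `η`: deviation `0`), window images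
  `{nL/2 ≤ x⁰ ≤ nL/2 + L}`, chained, leaving every compact past (`J⁻(K) ⊆ {x⁰ ≤ max_K x⁰}`), pinning
  `O = J⁺(ι ℝ³) ∩ I⁻(⋃ windows)`, covering `O` — assembled through the landed flat-window form of the
  seam `isAdiabaticallyTracked_zero_iff_flatWindows`. The first kernel-checked instance of
  `VacuumCauchyDevelopment.IsAdiabaticallyTracked` (Klainerman 2025, §2.3: orbital closeness, here exact).
* (C) `driftCapture_hypotheses_minkowski`, `driftCapture_zero_minkowski` — given the Choquet-Bruhat–Geroch
  existence theorem (`choquetBruhat_geroch_exists_mghd_cauchy`, hypothesis), EVERY hypothesis of the crux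
  at `N = 0` holds at ONE certified MGHD (admissible datum, `Minkowski.isMaximal_vacuumCauchyDevelopment`,
  complete `𝓘⁺`, tracked at every accuracy), and applying (A) there gives its conclusion: the `N = 0`
  instance is non-vacuous and true. A counterexample to `DriftCapture` needs `N ≥ 1` or a non-flat datum.

Only theorems (no definition, no named fact, no notation, no `sorry`); the translated identity charts
enter the lemmas of (B) as a section variable `φ` pinned by the hypothesis
`hφ : φ = fun t ↦ Subtype.val ∘ ModelBackground.translate 𝔹 𝔹 (t ∂₀) _`, `𝔹 = Minkowski.backgroundOn ⊤`.

References: Choquet-Bruhat–Geroch, CMP 14 (1969), Thm. 3; O'Neill, *Semi-Riemannian Geometry* (1983),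
Cor. 7.29 and Ch. 14, p. 402; Christodoulou–Klainerman (1993), Thm. 1.0.2; Klainerman, C. R. Mécanique
353 (2025), §2.3; DHRT arXiv:2104.08222, §1; Dafermos–Luk arXiv:1710.01722, Conjecture 1.
-/

noncomputable section

-- every `Summit.FinalStateConjecture.FinalStateConjecture.…` name repeats the summit = sub-problem segment (D-0017 layout)
set_option linter.dupNamespace false

open Set Filter Function TopologicalSpace
open scoped Manifold ContDiff Topology ENNReal

namespace Summit.FinalStateConjecture.FinalStateConjecture.Theorems.RenormalisedDrift.DriftCapture

open Literature.Geometry.Lorentzian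
open Summit.FinalStateConjecture.FinalStateConjecture.Theorems.ChannelsResolveTameDevelopmentsR.TrivialDatum
  (settlesT2_minkowski)
open Summit.FinalStateConjecture.FinalStateConjecture.Theorems.ClusterCompleteness (SettlesT2)
open Summit.FinalStateConjecture.FinalStateConjecture.Theorems.OneLockedExplosion
  (transportDecomposition charted_transportDecomposition mdifferentiable_diffeomorph image_exteriorOf
    hasExhaustiveCharts_transportDecomposition)
open Summit.FinalStateConjecture.FinalStateConjecture.Theorems.PhaseMixingCapture.WeakCosmicCensorshipMGHD
  (hasCompleteNullInfinity_iff_of_isIsometricTo)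
open Summit.FinalStateConjecture.FinalStateConjecture.Theorems.EIHFluxBalance.TameTemplate
  (stub_raysStayInClosure_transport stub_rayTransport)
open Summit.FinalStateConjecture.FinalStateConjecture.Theorems.UniversalWitnessFamily.Negative
  (minkowskiExterior causalFuture_range_sliceEmbed chronologicalPast_late)
open Summit.FinalStateConjecture.FinalStateConjecture.Theorems.SeamedChartsExhaust.Negative.ReversedModel
  (exists_mem_causalPast_singleton_of_mem_causalPast time_le_of_mem_causalPast_singleton)

/-! ### (A) The body of the crux on the whole fibre over the trivial datum -/

-- `isFutureOriented_transport` and `settlesT2_of_isMaximal` are adapted verbatim from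
-- `Theorems/PhotonSphereChannelsChannelsResolveTameDevelopmentsRTrivialDatumMGHD.lean` (no olean on the farm).

/-- **Future orientation of a final-state decomposition is transported along a time-orientation
preserving isometric diffeomorphism `ψ : 𝓢₁ ≃ 𝓢₂`** (motions kept; chain rule and O'Neill's timecone
lemma `PreservesTimeOrientation.isFutureDirected_mfderiv`). [cite: ONeillSemiRiemannian1983, Ch. 5, p. 145] -/
private theorem isFutureOriented_transport {𝓢₁ 𝓢₂ : Spacetime.{0} 4}
    (ψ : Diffeomorph (𝓡 4) (𝓡 4) 𝓢₁.carrier 𝓢₂.carrier ∞)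
    (hiso : 𝓢₁.metric.IsIsometry 𝓢₂.metric.toPseudoRiemannianMetric ψ)
    (hτ : 𝓢₁.timeOrientation.PreservesTimeOrientation ψ 𝓢₂.timeOrientation)
    {O : Set 𝓢₁.carrier} {k : ℕ} (d : FinalStateDecomposition 𝓢₁ O k)
    (h : Summit.FinalStateConjecture.IsFutureOriented d) :
    Summit.FinalStateConjecture.IsFutureOriented (transportDecomposition ψ hiso hτ d) := by
  have step : ∀ {U : Opens E4} {Ψ : U → 𝓢₁.carrier}, ContMDiff 𝓘(ℝ, E4) (𝓡 4) ∞ Ψ →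
      ∀ {x : U} {v : E4}, 𝓢₁.timeOrientation.IsFutureDirected (mfderiv 𝓘(ℝ, E4) (𝓡 4) Ψ x v) →
        𝓢₂.timeOrientation.IsFutureDirected (mfderiv 𝓘(ℝ, E4) (𝓡 4) (ψ ∘ Ψ) x v) := by
    intro U Ψ hΨ x v hv
    have hc : MDifferentiableAt 𝓘(ℝ, E4) (𝓡 4) Ψ x := (hΨ.mdifferentiable (by simp)) x
    rw [mfderiv_comp x (mdifferentiable_diffeomorph ψ _) hc]
    exact hτ.isFutureDirected_mfderiv hiso hv
  obtain ⟨h₁, h₂, h₃⟩ := h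
  refine ⟨h₁, fun i ρ ↦ (h₂ i ρ).mono fun τ hτ' x hx ↦ ?_, h₃.mono fun τ hτ' x hx ↦ ?_⟩
  · exact step (d.isLateChart i).contMDiff (hτ' x hx)
  · exact step d.isLateChart_flat.contMDiff (hτ' x hx)

/-- **Every maximal vacuum Cauchy development of the trivial datum settles in the T2 sense**,
unconditionally: `𝒟` is isometric, as a development, to Minkowski space
(`Minkowski.isIsometricTo_vacuumCauchyDevelopment_of_isMaximal`), Minkowski space settles (T2)
(`settlesT2_minkowski`), and each clause is transported along the isometry `ψ` (complete `𝓘⁺`,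
the decomposition with `ψ(O) = exteriorOf 𝒟 ψ(charted)` (`image_exteriorOf`), rays, exhaustion,
orientation). [cite: Ringstrom2009, Thm. 16.6] -/
private theorem settlesT2_of_isMaximal (𝒟 : VacuumCauchyDevelopment trivialData) (hmax : 𝒟.IsMaximal) :
    SettlesT2 𝒟 := by
  have h := Minkowski.isIsometricTo_vacuumCauchyDevelopment_of_isMaximal hmax
  obtain ⟨hI, O, d, hsub, hO, hrays, hex, hfo⟩ := settlesT2_minkowski
  refine ⟨(hasCompleteNullInfinity_iff_of_isIsometricTo _ _ h).1 hI, ?_⟩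
  obtain ⟨ψ, hiso, hτ, hι⟩ := h
  refine ⟨ψ '' O, transportDecomposition (𝓢₁ := Minkowski.vacuumCauchyDevelopment.toSpacetime)
      (𝓢₂ := 𝒟.toSpacetime) ψ hiso hτ d, hsub, ?_, ?_,
    hasExhaustiveCharts_transportDecomposition _ hiso hτ d hex, isFutureOriented_transport _ hiso hτ d hfo⟩
  · rw [charted_transportDecomposition, ← image_exteriorOf ψ hiso hτ hι, ← hO]
  · exact stub_raysStayInClosure_transport _ trivialData Minkowski.vacuumCauchyDevelopment 𝒟 ψ hiso hτ hι
      (fun p γ dom ↦ stub_rayTransport _ trivialData Minkowski.vacuumCauchyDevelopment 𝒟 ψ hiso hτ hι p γ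
        dom) O hrays

/-- **(A) THE BODY OF `DriftCapture` AT `X = Minkowski.slice`, `D = trivialData` HOLDS FOR EVERY MAXIMAL
DEVELOPMENT AND EVERY `(N, m₀, χ)`, UNCONDITIONALLY** (registered sub-goal `driftCapture_trivialData` of
crux stmt-FinalStateConjecture-17391; one-line header = registered signature): the conclusion is the second
component of `SettlesT2 𝒟` (`settlesT2_of_isMaximal`); the hypotheses `0 < m₀`, `0 ≤ χ < 1`, complete
`𝓘⁺` and all-accuracy tracking are idle. Choquet-Bruhat–Geroch 1969, Thm. 3; O'Neill 1983, Cor. 7.29;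
Christodoulou–Klainerman 1993, Thm. 1.0.2. [cite: ChristodoulouKlainerman1993, Thm. 1.0.2] -/
theorem driftCapture_trivialData : ∀ (N : ℕ) (m₀ χ : ℝ), 0 < m₀ → 0 ≤ χ → χ < 1 → ∀ 𝒟 : VacuumCauchyDevelopment trivialData, 𝒟.IsMaximal → Summit.FinalStateConjecture.HasCompleteNullInfinity 𝒟.toCauchyDevelopment → (∀ (L : ℝ) (ε : ENNReal) (R₀ : ℝ), 0 < L → 0 < ε → 𝒟.IsAdiabaticallyTracked N m₀ χ ε L R₀) → ∃ (O' : Set 𝒟.carrier) (d : FinalStateDecomposition 𝒟.toSpacetime O' 2), (∀ i, Kerr.IsSubextremal (d.mass i) (d.spin i)) ∧ O' = Summit.FinalStateConjecture.exteriorOf 𝒟.toCauchyDevelopment d.charted ∧ Summit.FinalStateConjecture.RaysStayInClosure 𝒟.toCauchyDevelopment O' ∧ Summit.FinalStateConjecture.HasExhaustiveCharts d ∧ Summit.FinalStateConjecture.IsFutureOriented d := by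
  intro _ _ _ _ _ _ 𝒟 hmax _ _
  exact (settlesT2_of_isMaximal 𝒟 hmax).2

/-! ### (B) The translated identity charts of Minkowski space -/

/-- Every point of `E4` lies in the domain `⊤ = E4` of the flat reference background (stated over
`(Minkowski.backgroundOn ⊤).domain` verbatim: the translated charts stay type-correct at every transparency). -/
theorem mem_domain_backgroundOn_top (y : E4) :
    y ∈ ((Minkowski.backgroundOn (⊤ : Opens E4)).domain : Set E4) := trivial

/-- Lab time of the flat background is shifted by `t` under the translation by `t ∂₀`. [folklore] -/
theorem time_backgroundOn_top_shift (t : ℝ) : ∀ x : E4, (Minkowski.backgroundOn ⊤).time x =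
    (Minkowski.backgroundOn ⊤).time (x + t • E4.basisVector 0) - t := fun x ↦ by
  change x 0 = (x + t • E4.basisVector 0) 0 - t
  simp

/-- Arithmetic of consecutive window start times: `(n + 1)L/2 = nL/2 + L/2`. [folklore] -/
theorem cast_succ_mul_half (n : ℕ) (L : ℝ) :
    ((n + 1 : ℕ) : ℝ) * (L / 2) = (n : ℝ) * (L / 2) + L / 2 := by push_cast; ring

section Shift

/-! In this section `φ t` is the identity chart of Minkowski space translated by `t` along `∂₀`,
`y ↦ y + t ∂₀`, on the flat domain `⊤ = E4` — a section variable pinned by `hφ` (no definition). -/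

variable {φ : ℝ → (Minkowski.backgroundOn (⊤ : Opens E4)).domain → E4}
  (hφ : φ = fun t ↦ Subtype.val ∘ (Minkowski.backgroundOn ⊤).translate (Minkowski.backgroundOn ⊤)
    (t • E4.basisVector 0) fun x _ ↦ mem_domain_backgroundOn_top (x + t • E4.basisVector 0))

include hφ

/-- The translated identity chart maps the flat slab `{x⁰ = σ}` onto the slab `{x⁰ = t + σ}`. [folklore] -/
theorem mem_image_shiftChart_timeSlab {t σ : ℝ} {x : E4} :
    x ∈ φ t '' (Minkowski.backgroundOn ⊤).timeSlab σ ↔ x 0 = t + σ := by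
  subst hφ
  constructor
  · rintro ⟨y, hy, rfl⟩
    have hy' : y.1 0 = σ := hy
    show (y.1 + t • E4.basisVector 0) 0 = t + σ
    simp [hy', add_comm]
  · intro hx
    refine ⟨⟨x - t • E4.basisVector 0, trivial⟩, ?_, ?_⟩
    · show (x - t • E4.basisVector 0) 0 = σ
      simp [hx]
    · show x - t • E4.basisVector 0 + t • E4.basisVector 0 = x
      exact sub_add_cancel x _

/-- The translated identity chart maps the flat window `{x⁰ ∈ [0, L]}` onto the slab region
`{t ≤ x⁰ ≤ t + L}`. [folklore] -/
theorem mem_image_shiftChart_window {t L : ℝ} {x : E4} :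
    x ∈ φ t '' (Minkowski.backgroundOn ⊤).window 0 L ↔ t ≤ x 0 ∧ x 0 ≤ t + L := by
  subst hφ
  constructor
  · rintro ⟨y, hy, rfl⟩
    have hy' : y.1 0 ∈ Icc 0 (0 + L) := hy
    rw [mem_Icc] at hy'
    show t ≤ (y.1 + t • E4.basisVector 0) 0 ∧ (y.1 + t • E4.basisVector 0) 0 ≤ t + L
    have h0 : (y.1 + t • E4.basisVector 0) 0 = y.1 0 + t := by simp
    rw [h0]
    exact ⟨by linarith [hy'.1], by linarith [hy'.2]⟩
  · rintro ⟨h1, h2⟩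
    refine ⟨⟨x - t • E4.basisVector 0, trivial⟩, ?_, ?_⟩
    · show (x - t • E4.basisVector 0) 0 ∈ Icc 0 (0 + L)
      have h0 : (x - t • E4.basisVector 0) 0 = x 0 - t := by simp
      rw [h0, mem_Icc]
      exact ⟨by linarith, by linarith⟩
    · show x - t • E4.basisVector 0 + t • E4.basisVector 0 = x
      exact sub_add_cancel x _

/-- **The translated identity chart is an exact isometry of `η`**: its `C²` deviation from the flat
background vanishes on every slab (the deviation of a translated chart is the translated deviation,
`Spacetime.deviationCk_comp_translate`, and the identity chart has deviation `0`,
`Minkowski.deviationCk_vacuumCauchyDevelopment_subtypeVal`). [cite: ChristodoulouKlainerman1993, Thm. 1.0.2] -/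
theorem deviationCk_shiftChart (t σ : ℝ) :
    Minkowski.vacuumCauchyDevelopment.toSpacetime.deviationCk (Minkowski.backgroundOn ⊤) (φ t) 2 σ = 0 := by
  subst hφ
  exact (Spacetime.deviationCk_comp_translate Minkowski.vacuumCauchyDevelopment.toSpacetime
      (Minkowski.backgroundOn ⊤) (Minkowski.backgroundOn ⊤) (t • E4.basisVector 0)
      (fun x _ ↦ mem_domain_backgroundOn_top (x + t • E4.basisVector 0)) Subtype.val (fun _ _ ↦ rfl)
      (fun y _ ↦ mem_domain_backgroundOn_top (y - t • E4.basisVector 0)) (time_backgroundOn_top_shift t)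
      (Minkowski.isLateChart_vacuumCauchyDevelopment_subtypeVal 0).contMDiff 2 σ).trans
    (Minkowski.deviationCk_vacuumCauchyDevelopment_subtypeVal 2 (σ + t))

/-- **The translated identity chart is a window chart** into `O = {x⁰ ≥ 0}` for the flat window
`{x⁰ ∈ [0, L]}`, as soon as `t ≥ 0`: smooth, an open embedding of all of `E4` (a translation), and the
window is carried onto `{t ≤ x⁰ ≤ t + L} ⊆ O`. [cite: arXiv210408222, §1] -/
theorem isWindowChart_shiftChart {t : ℝ} (ht : 0 ≤ t) (L : ℝ) :
    Minkowski.vacuumCauchyDevelopment.toSpacetime.IsWindowChart (Minkowski.backgroundOn ⊤) minkowskiExterior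
      ((Minkowski.backgroundOn ⊤).window 0 L) (φ t) := by
  refine ⟨?_, ⟨univ, isOpen_univ, subset_univ _, ?_⟩, fun (x : E4) hx ↦
    (show (0 : ℝ) ≤ x 0 from ht.trans ((mem_image_shiftChart_window hφ).mp hx).1)⟩
  · subst hφ
    exact (Minkowski.isLateChart_vacuumCauchyDevelopment_subtypeVal 0).contMDiff.comp
      (ModelBackground.contMDiff_translate (Minkowski.backgroundOn ⊤) (Minkowski.backgroundOn ⊤) _ _)
  · subst hφ
    exact ((IsOpen.isOpenEmbedding_subtypeVal (⊤ : Opens E4).isOpen).comp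
      (ModelBackground.isOpenEmbedding_translate (Minkowski.backgroundOn ⊤) (Minkowski.backgroundOn ⊤)
        (t • E4.basisVector 0) (fun x _ ↦ mem_domain_backgroundOn_top (x + t • E4.basisVector 0))
        (fun y _ ↦ mem_domain_backgroundOn_top (y - t • E4.basisVector 0)))).comp
      (IsOpen.isOpenEmbedding_subtypeVal isOpen_univ)

/-- **Causal trichotomy of a translated flat window**: a point off `{t ≤ x⁰ ≤ t + L}` lies in the causal
past of the slab `{x⁰ = t}` (vertical segment up to `(t, x̲)`) or in the causal future of the slab
`{x⁰ = t + L}` (vertical segment from `(t + L, x̲)`); `Minkowski.causalPast_singleton`,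
`Minkowski.causalFuture_singleton`. [cite: ONeillSemiRiemannian1983, Ch. 14, p. 402] -/
theorem compl_window_subset_shiftChart (t L : ℝ) :
    (φ t '' (Minkowski.backgroundOn ⊤).window 0 L)ᶜ ⊆
      Minkowski.vacuumCauchyDevelopment.metric.causalPast Minkowski.vacuumCauchyDevelopment.timeOrientation
          (φ t '' (Minkowski.backgroundOn ⊤).timeSlab 0) ∪
        Minkowski.vacuumCauchyDevelopment.metric.causalFuture
          Minkowski.vacuumCauchyDevelopment.timeOrientation (φ t '' (Minkowski.backgroundOn ⊤).timeSlab L) := by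
  intro x hx
  have hx' : ¬ (t ≤ x 0 ∧ x 0 ≤ t + L) := fun h ↦ hx ((mem_image_shiftChart_window hφ).mpr h)
  rcases lt_or_ge (x 0) t with hlt | hge
  · refine Or.inl ?_
    change x ∈ Minkowski.spacetime.metric.causalPast Minkowski.spacetime.timeOrientation _
    have hJ : x ∈ Minkowski.spacetime.metric.causalPast Minkowski.spacetime.timeOrientation
        ({E4.ofTimeSpace t (E4.spatial x)} : Set E4) := by
      refine Minkowski.mem_causalPast_vacuumCauchyDevelopment ?_
      simp only [E4.spatial_ofTimeSpace, sub_self, norm_zero, E4.ofTimeSpace_apply_zero, sub_nonneg]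
      exact hlt.le
    refine LorentzianMetric.causalFuture_mono (M := Minkowski.spacetime.carrier) ?_ hJ
    refine singleton_subset_iff.mpr ((mem_image_shiftChart_timeSlab hφ).mpr ?_)
    rw [E4.ofTimeSpace_apply_zero, add_zero]
  · refine Or.inr ?_
    change x ∈ Minkowski.spacetime.metric.causalFuture Minkowski.spacetime.timeOrientation _
    have hgt : t + L < x 0 := by
      by_contra h
      exact hx' ⟨hge, not_lt.mp h⟩
    have hJ : x ∈ Minkowski.spacetime.metric.causalFuture Minkowski.spacetime.timeOrientation
        ({E4.ofTimeSpace (t + L) (E4.spatial x)} : Set E4) := by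
      refine Minkowski.mem_causalFuture_vacuumCauchyDevelopment ?_
      simp only [E4.spatial_ofTimeSpace, sub_self, norm_zero, E4.ofTimeSpace_apply_zero, sub_nonneg]
      exact hgt.le
    refine LorentzianMetric.causalFuture_mono (M := Minkowski.spacetime.carrier) ?_ hJ
    exact singleton_subset_iff.mpr ((mem_image_shiftChart_timeSlab hφ).mpr (E4.ofTimeSpace_apply_zero _ _))

/-- **Chaining**: the start slab `{x⁰ = t'}` lies in the window region `{t ≤ x⁰ ≤ t + L}` if `t ≤ t' ≤ t + L`. -/
theorem image_timeSlab_subset_image_window {t t' L : ℝ} (h₁ : t ≤ t') (h₂ : t' ≤ t + L) :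
    φ t' '' (Minkowski.backgroundOn ⊤).timeSlab 0 ⊆ φ t '' (Minkowski.backgroundOn ⊤).window 0 L := by
  intro x hx
  have hx' : x 0 = t' + 0 := (mem_image_shiftChart_timeSlab hφ).mp hx
  rw [add_zero] at hx'
  refine (mem_image_shiftChart_window hφ).mpr ?_
  rw [hx']
  exact ⟨h₁, h₂⟩

/-- **Exhaustion**: the windows `{nL/2 ≤ x⁰ ≤ nL/2 + L}` eventually leave the causal past of every compact
set `K` — `x⁰ ≤ T` on `K`, `J⁻(K) ⊆ {x⁰ ≤ T}` because time does not increase towards the past along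
causal curves of Minkowski space (`Minkowski.causalPast_singleton`), and `nL/2 > T` for large `n`.
[cite: ONeillSemiRiemannian1983, Ch. 14, p. 402] -/
theorem eventually_disjoint_window_causalPast {L : ℝ} (hL : 0 < L)
    (K : Set Minkowski.vacuumCauchyDevelopment.carrier) (hK : IsCompact K) :
    ∃ n₀ : ℕ, ∀ n, n₀ ≤ n →
      Disjoint (φ ((n : ℝ) * (L / 2)) '' (Minkowski.backgroundOn ⊤).window 0 L)
        (Minkowski.vacuumCauchyDevelopment.metric.causalPast
          Minkowski.vacuumCauchyDevelopment.timeOrientation K) := by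
  obtain ⟨T, hT⟩ := hK.bddAbove_image (f := fun x : E4 ↦ x 0) (PiLp.continuous_apply 2 _ 0).continuousOn
  obtain ⟨n₀, hn₀⟩ := exists_nat_gt (T / (L / 2))
  refine ⟨n₀, fun n hn ↦ Set.disjoint_left.mpr fun x hxW hxJ ↦ ?_⟩
  have hxW' := (mem_image_shiftChart_window hφ).mp hxW
  obtain ⟨q, hqK, hxq⟩ := exists_mem_causalPast_singleton_of_mem_causalPast hxJ
  have h1 : x 0 ≤ q 0 := time_le_of_mem_causalPast_singleton hxq
  have h2 : q 0 ≤ T := hT ⟨q, hqK, rfl⟩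
  have hL2 : 0 < L / 2 := half_pos hL
  have h3 : T < (n₀ : ℝ) * (L / 2) := (div_lt_iff₀ hL2).mp hn₀
  have h4 : (n₀ : ℝ) * (L / 2) ≤ (n : ℝ) * (L / 2) :=
    mul_le_mul_of_nonneg_right (Nat.cast_le.mpr hn) hL2.le
  linarith [hxW'.1]

/-- **Covering**: every point of `O = {x⁰ ≥ 0}` lies in the window `{nL/2 ≤ x⁰ ≤ nL/2 + L}`, `n = ⌊2x⁰/L⌋`. -/
theorem minkowskiExterior_subset_iUnion_window {L : ℝ} (hL : 0 < L) :
    minkowskiExterior ⊆ ⋃ n : ℕ, φ ((n : ℝ) * (L / 2)) '' (Minkowski.backgroundOn ⊤).window 0 L := by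
  intro x hx
  have hx0 : (0 : ℝ) ≤ x 0 := hx
  have hL2 : 0 < L / 2 := half_pos hL
  refine mem_iUnion.mpr ⟨⌊x 0 / (L / 2)⌋₊, (mem_image_shiftChart_window hφ).mpr ?_⟩
  have h1 : (⌊x 0 / (L / 2)⌋₊ : ℝ) ≤ x 0 / (L / 2) := Nat.floor_le (div_nonneg hx0 hL2.le)
  have h2 : x 0 / (L / 2) < (⌊x 0 / (L / 2)⌋₊ : ℝ) + 1 := Nat.lt_floor_add_one _
  have h1' := (le_div_iff₀ hL2).mp h1
  have h2' := (div_lt_iff₀ hL2).mp h2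
  refine ⟨h1', ?_⟩
  have h5 : ((⌊x 0 / (L / 2)⌋₊ : ℝ) + 1) * (L / 2) = (⌊x 0 / (L / 2)⌋₊ : ℝ) * (L / 2) + L / 2 := by ring
  rw [h5] at h2'
  linarith

/-- **Pinning**: `O = {x⁰ ≥ 0}` is the self-determined exterior `J⁺(ι ℝ³) ∩ I⁻(⋃ₙ windows)` of the chain
of flat windows (`J⁺({x⁰ = 0}) = {x⁰ ≥ 0}`, `causalFuture_range_sliceEmbed`; `I⁻({x⁰ > 0}) = ℝ⁴`,
`chronologicalPast_late`; the windows cover `{x⁰ > 0}`). [cite: DafermosLuk2017, Conjecture 1] -/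
theorem minkowskiExterior_eq_exteriorOf_iUnion_window {L : ℝ} (hL : 0 < L) :
    minkowskiExterior = Minkowski.vacuumCauchyDevelopment.toCauchyDevelopment.exteriorOf
      (⋃ n : ℕ, φ ((n : ℝ) * (L / 2)) '' (Minkowski.backgroundOn ⊤).window 0 L) := by
  have hcov := minkowskiExterior_subset_iUnion_window hφ hL
  change minkowskiExterior =
    Minkowski.spacetime.metric.causalFuture Minkowski.spacetime.timeOrientation (range Minkowski.sliceEmbed) ∩
      Minkowski.spacetime.metric.chronologicalPast Minkowski.spacetime.timeOrientation _
  rw [causalFuture_range_sliceEmbed]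
  refine Set.ext fun (x : E4) ↦ ⟨fun hx ↦ ⟨hx, ?_⟩, fun hx ↦ hx.1⟩
  have huniv := (Set.ext_iff.mp (chronologicalPast_late 0) x).mpr (mem_univ x)
  refine LorentzianMetric.chronologicalFuture_mono (M := Minkowski.spacetime.carrier) ?_ huniv
  exact fun (y : E4) (hy : (0 : ℝ) < y 0) ↦ hcov (show (0 : ℝ) ≤ y 0 from hy.le)

end Shift

/-! ### (B) The `N = 0` hypothesis of the crux is realised in Minkowski space -/

/-- **(B) THE `N = 0` HYPOTHESIS OF `DriftCapture` IS REALISED IN MINKOWSKI SPACE** (registered sub-goal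
`isAdiabaticallyTracked_zero_minkowski` of crux stmt-FinalStateConjecture-17391; one-line header =
registered signature). For every `L > 0` and EVERY accuracy `ε` (no positivity needed), every `m₀`, `χ`,
`R₀`, the Minkowski development of the trivial datum is adiabatically tracked with NO hole: `O = {x⁰ ≥ 0}`,
`Uₙ = E4`, charts `φₙ(y) = y + (nL/2) ∂₀` — exact isometries of `η` (`deviationCk_shiftChart`), window
charts with images `{nL/2 ≤ x⁰ ≤ nL/2 + L} ⊆ O` (`isWindowChart_shiftChart`), causal trichotomy
(`compl_window_subset_shiftChart`) — chained (`(n+1)L/2 ∈ [nL/2, nL/2 + L]`), leaving every compact past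
(`eventually_disjoint_window_causalPast`), pinning `O = J⁺(ι ℝ³) ∩ I⁻(⋃ windows)`
(`minkowskiExterior_eq_exteriorOf_iUnion_window`) and covering `O` (`minkowskiExterior_subset_iUnion_window`);
assembled through `isAdiabaticallyTracked_zero_iff_flatWindows`. Christodoulou–Klainerman 1993, Thm. 1.0.2;
Klainerman, C. R. Mécanique 353 (2025), §2.3 (orbital closeness, here exact).
[cite: ChristodoulouKlainerman1993, Thm. 1.0.2] -/
theorem isAdiabaticallyTracked_zero_minkowski : ∀ (m₀ χ : ℝ) (ε : ENNReal) (L R₀ : ℝ), 0 < L → Minkowski.vacuumCauchyDevelopment.IsAdiabaticallyTracked 0 m₀ χ ε L R₀ := by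
  intro m₀ χ ε L R₀ hL
  -- the translated identity charts `φ t : y ↦ y + t ∂₀` on the flat domain `⊤ = E4`
  obtain ⟨φ, hφ⟩ : ∃ φ : ℝ → (Minkowski.backgroundOn (⊤ : Opens E4)).domain → E4,
      φ = fun t ↦ Subtype.val ∘ (Minkowski.backgroundOn ⊤).translate (Minkowski.backgroundOn ⊤)
        (t • E4.basisVector 0) fun x _ ↦ mem_domain_backgroundOn_top (x + t • E4.basisVector 0) :=
    ⟨_, rfl⟩
  refine (isAdiabaticallyTracked_zero_iff_flatWindows Minkowski.vacuumCauchyDevelopment m₀ χ ε L R₀).mpr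
    ⟨minkowskiExterior, fun _ ↦ ⊤, fun n ↦ φ ((n : ℝ) * (L / 2)), fun _ _ _ ↦ trivial,
      fun n ↦ isWindowChart_shiftChart hφ (mul_nonneg n.cast_nonneg (half_pos hL).le) L,
      fun n σ _ ↦ (deviationCk_shiftChart hφ _ σ).trans_le (zero_le (a := ε)),
      fun n x hx ↦ compl_window_subset_shiftChart hφ _ L hx.2,
      fun n ↦ image_timeSlab_subset_image_window hφ ?_ ?_,
      eventually_disjoint_window_causalPast hφ hL,
      minkowskiExterior_eq_exteriorOf_iUnion_window hφ hL,
      fun x hx ↦ Or.inr (minkowskiExterior_subset_iUnion_window hφ hL hx)⟩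
  · rw [cast_succ_mul_half]; linarith
  · rw [cast_succ_mul_half]; linarith

/-! ### (C) Every hypothesis of the crux at `N = 0` holds at one certified MGHD -/

/-- **(C) THE HYPOTHESES OF `DriftCapture` AT `N = 0` ARE JOINTLY REALISED AT A CERTIFIED MGHD.** Given the
Choquet-Bruhat–Geroch existence theorem (`choquetBruhat_geroch_exists_mghd_cauchy`, hypothesis `hcbg`): the
trivial datum `(ℝ³, δ, 0)` is admissible (`trivialData_mem_admissibleVacuumData`), its Minkowski
development is MAXIMAL (`Minkowski.isMaximal_vacuumCauchyDevelopment hcbg`: geodesically complete, O'Neill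
1983, Cor. 7.29, hence inextendible as a development, Choquet-Bruhat–Geroch 1969, Thm. 3), has complete
`𝓘⁺` (`settlesT2_minkowski`), and is adiabatically tracked with no hole at EVERY accuracy `(ε, L, R₀)`,
`L > 0`, `ε > 0` (by (B)). [cite: ChoquetBruhatGeroch1969CMP, Thm. 3] -/
theorem driftCapture_hypotheses_minkowski (hcbg : choquetBruhat_geroch_exists_mghd_cauchy) : trivialData ∈ admissibleVacuumData Minkowski.slice ∧ Minkowski.vacuumCauchyDevelopment.IsMaximal ∧ Summit.FinalStateConjecture.HasCompleteNullInfinity Minkowski.vacuumCauchyDevelopment.toCauchyDevelopment ∧ ∀ (m₀ χ : ℝ) (L : ℝ) (ε : ENNReal) (R₀ : ℝ), 0 < L → 0 < ε → Minkowski.vacuumCauchyDevelopment.IsAdiabaticallyTracked 0 m₀ χ ε L R₀ :=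
  ⟨trivialData_mem_admissibleVacuumData, Minkowski.isMaximal_vacuumCauchyDevelopment hcbg,
    settlesT2_minkowski.1, fun m₀ χ L ε R₀ hL _ ↦ isAdiabaticallyTracked_zero_minkowski m₀ χ ε L R₀ hL⟩

/-- **The `N = 0` instance of `DriftCapture` at the Minkowski development, hypotheses discharged**: given
the Choquet-Bruhat–Geroch existence theorem, for every `m₀ > 0` and `0 ≤ χ < 1` the conclusion of the crux
holds at `𝒟 = Minkowski.vacuumCauchyDevelopment`, obtained by APPLYING (A) to the hypotheses certified in
(C) (the implication is exercised, not merely its conclusion re-proved). [cite: ChristodoulouKlainerman1993, Thm. 1.0.2] -/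
theorem driftCapture_zero_minkowski (hcbg : choquetBruhat_geroch_exists_mghd_cauchy) (m₀ χ : ℝ)
    (hm₀ : 0 < m₀) (hχ₀ : 0 ≤ χ) (hχ₁ : χ < 1) :
    ∃ (O' : Set Minkowski.vacuumCauchyDevelopment.carrier)
      (d : FinalStateDecomposition Minkowski.vacuumCauchyDevelopment.toSpacetime O' 2),
      (∀ i, Kerr.IsSubextremal (d.mass i) (d.spin i)) ∧
        O' = Summit.FinalStateConjecture.exteriorOf Minkowski.vacuumCauchyDevelopment.toCauchyDevelopment
          d.charted ∧
        Summit.FinalStateConjecture.RaysStayInClosure Minkowski.vacuumCauchyDevelopment.toCauchyDevelopment O' ∧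
        Summit.FinalStateConjecture.HasExhaustiveCharts d ∧ Summit.FinalStateConjecture.IsFutureOriented d :=
  have h := driftCapture_hypotheses_minkowski hcbg
  driftCapture_trivialData 0 m₀ χ hm₀ hχ₀ hχ₁ Minkowski.vacuumCauchyDevelopment h.2.1 h.2.2.1
    (fun L ε R₀ hL hε ↦ h.2.2.2 m₀ χ L ε R₀ hL hε)

end Summit.FinalStateConjecture.FinalStateConjecture.Theorems.RenormalisedDrift.DriftCapture

end
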